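import Mathlib
import Summits.ValiantsHypothesis.ValiantsHypothesis.Theorems.FifoMatchingNNLinearDegreeCofactorHardShedWordHistory
import HarnessLib

/-!
# Crux `NNLinearDegreeCofactorHard` (stmt-ValiantsHypothesis-23918), line `internal_cofactor`, stub S2b (ii):
# the shed queue word — the S-CONTENT is the fill plus the fair walk (design memo §1, «Z_S is a martingale»)

For `shedWord R H E y` (`…ShedWordDefs/Queue/History`): the S-CONTENT `sContent t` is the number of items in the queue
after the length-`t` prefix that were NOT pushed at a defect.  Deterministic bookkeeping:

* `isRItem_pushes` / `isRItem_pops` — the item pushed at time `t` is an R-item iff `t` is a defect; the item popped at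
  time `t` (the front) is an R-item iff the front was pushed at a defect;
* `sContent_succ` — one step: a defect push and a shed pop leave the S-content unchanged, a fill / empty-queue push adds
  one, a FAIR letter adds `±1` according to its bit;
* `sContent_fill` — after the fill the S-content is `freeCount R 0 H` (the non-defect fill positions);
* `sContent_eq` — for `H ≤ t ≤ E` (`E ≤ N`): `sContent t = freeCount R 0 H + emptyPushes t + fairWalk t`, where
  `fairWalk t = Σ_{s < t fair} (bit ? 1 : −1)` and `emptyPushes` counts empty-queue pushes in `[H, t)`;
* `sContent_eq_of_walk_gt` — if the fair walk stays above `−freeCount R 0 H` on `[H, t]` then no empty-queue push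
  occurs, the queue is never empty there, and `sContent = freeCount R 0 H + fairWalk` exactly (the BAND of the design
  is thus an event about the fair walk alone, priced in the sequel).

Honest framing: bookkeeping; nothing here proves (D*), S2b, the crux or VP ≠ VNP (not proved). [folklore]
-/

noncomputable section

-- Sub = Summit single-conjunct layout: the duplicated namespace component is mandated by the tree.
set_option linter.dupNamespace false

namespace Summit.ValiantsHypothesis.ValiantsHypothesis.Theorems.FifoMatching.NNLinearDegreeCofactorHard.ShedWord

open Finset

variable {N : ℕ} (R : Finset (Fin N)) (H E : ℕ) (y : Fin N → Bool)

/-- The S-CONTENT after the length-`t` prefix: queue items (indices `pops ≤ k < pushes`) not pushed at a defect.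
[folklore] -/
def sContent (t : ℕ) : ℕ :=
  ((Ico (pops (shedPrefix R H E y t)) (pushes (shedPrefix R H E y t))).filter fun k => isRItem R H E y k = false).card

/-- The FAIR WALK: `+1` for a fair push, `−1` for a fair pop, over the positions `< t`. [folklore] -/
def fairWalk (t : ℕ) : ℤ :=
  ∑ s ∈ range t, (if isFair R H E y s = true then (if bit y s = true then (1 : ℤ) else -1) else 0)

/-- The number of empty-queue pushes at non-defect positions of `[H, t)`. [folklore] -/
def emptyPushes (t : ℕ) : ℕ :=
  ((range t).filter fun s => H ≤ s ∧ isDefect R s = false ∧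
    pushes (shedPrefix R H E y s) ≤ pops (shedPrefix R H E y s)).card

/-! ### Which items are R-items -/

/-- The index of a push at the end of a prefix: `nthTrue (l ++ true :: m) (pushes l) = l.length`. [folklore] -/
theorem nthTrue_append_true : ∀ (l m : List Bool), nthTrue (l ++ true :: m) (pushes l) = l.length
  | [], m => by simp [pushes]
  | true :: l, m => by
      have : pushes (true :: l) = pushes l + 1 := by simp [pushes]
      rw [this]; simpa using nthTrue_append_true l m
  | false :: l, m => by
      have : pushes (false :: l) = pushes l := by simp [pushes]
      rw [this]; simpa using nthTrue_append_true l m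

/-- **The item pushed at time `t < N` is item `pushes (prefix t)`, pushed at position `t`.** [folklore] -/
theorem nthTrue_pushes_eq {t : ℕ} (ht : t < N) (hpush : shedLetter R H E y t = true) :
    nthTrue (shedPrefix R H E y N) (pushes (shedPrefix R H E y t)) = t := by
  have hsplit : shedPrefix R H E y N = shedPrefix R H E y t ++ true :: (shedPrefix R H E y N).drop (t + 1) := by
    conv_lhs => rw [← List.take_append_drop (t + 1) (shedPrefix R H E y N)]
    rw [take_shedPrefix R H E y ht, shedPrefix_succ, hpush, List.append_assoc]
    rfl
  rw [hsplit, nthTrue_append_true, length_shedPrefix]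

/-- The item pushed at time `t < N` is an R-item iff `t` is a defect. [folklore] -/
theorem isRItem_pushes {t : ℕ} (ht : t < N) (hpush : shedLetter R H E y t = true) :
    isRItem R H E y (pushes (shedPrefix R H E y t)) = isDefect R t := by
  unfold isRItem; rw [nthTrue_pushes_eq R H E y ht hpush]

/-- The front item at time `t ≤ N` (non-empty queue) is an R-item iff the front was pushed at a defect. [folklore] -/
theorem isRItem_pops {t : ℕ} (ht : t ≤ N) (hne : pops (shedPrefix R H E y t) < pushes (shedPrefix R H E y t)) :
    isRItem R H E y (pops (shedPrefix R H E y t)) = isDefect R (frontPos (shedPrefix R H E y t)) := by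
  unfold isRItem
  rw [frontPos_eq_openTime R H E y ht hne, openTime_eq_nthTrue]
  exact lt_of_lt_of_le hne (by rw [← pushes_shedPrefix_N]; exact pushes_mono R H E y ht)

/-! ### One step of the S-content -/

/-- A push appends the new item index to the queue interval. [folklore] -/
theorem sContent_succ_of_push {t : ℕ} (ht : t < N) (hpush : shedLetter R H E y t = true) :
    sContent R H E y (t + 1) = sContent R H E y t + (if isDefect R t = true then 0 else 1) := by
  unfold sContent
  rw [rankO_succ, rankC_succ, hpush]
  simp only [if_true, add_zero]
  rw [Nat.Ico_succ_right_eq_insert_Ico (pops_le_pushes R H E y t), filter_insert, isRItem_pushes R H E y ht hpush]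
  by_cases hd : isDefect R t = true
  · rw [hd]; simp
  · rw [Bool.not_eq_true] at hd
    rw [hd]
    simp only [if_true, Bool.false_eq_true, if_false]
    rw [card_insert_of_notMem]
    simp

/-- A pop removes the front index from the queue interval. [folklore] -/
theorem sContent_succ_of_pop {t : ℕ} (ht : t < N) (hpop : shedLetter R H E y t = false) :
    sContent R H E y (t + 1) + (if isDefect R (frontPos (shedPrefix R H E y t)) = true then 0 else 1) =
      sContent R H E y t := by
  have hne := (pops_lt_pushes_of_shedLetter_eq_false R H E y hpop).2.2
  unfold sContent
  rw [rankO_succ, rankC_succ, hpop]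
  simp only [Bool.false_eq_true, if_false, add_zero]
  rw [← isRItem_pops R H E y (le_of_lt ht) hne]
  have hIco : Ico (pops (shedPrefix R H E y t)) (pushes (shedPrefix R H E y t)) =
      insert (pops (shedPrefix R H E y t)) (Ico (pops (shedPrefix R H E y t) + 1) (pushes (shedPrefix R H E y t))) := by
    ext k; simp only [mem_Ico, mem_insert]; omega
  conv_rhs => rw [hIco, filter_insert]
  by_cases hr : isRItem R H E y (pops (shedPrefix R H E y t)) = true
  · rw [hr]; simp
  · rw [Bool.not_eq_true] at hr
    rw [hr]
    simp only [if_true, Bool.false_eq_true, if_false]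
    rw [card_insert_of_notMem]
    simp

/-- One step of the fair walk. [folklore] -/
theorem fairWalk_succ (t : ℕ) : fairWalk R H E y (t + 1) = fairWalk R H E y t +
    (if isFair R H E y t = true then (if bit y t = true then (1 : ℤ) else -1) else 0) := by
  unfold fairWalk; rw [sum_range_succ]

/-- One step of the empty-push count. [folklore] -/
theorem emptyPushes_succ (t : ℕ) : emptyPushes R H E y (t + 1) = emptyPushes R H E y t +
    (if H ≤ t ∧ isDefect R t = false ∧ pushes (shedPrefix R H E y t) ≤ pops (shedPrefix R H E y t) then 1 else 0) := by
  unfold emptyPushes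
  rw [range_add_one, filter_insert]
  split_ifs with h
  · rw [card_insert_of_notMem]
    simp
  · rfl

/-- The fair walk vanishes through the fill (no fair position `< H`). [folklore] -/
theorem fairWalk_of_le {t : ℕ} (ht : t ≤ H) : fairWalk R H E y t = 0 := by
  unfold fairWalk
  refine sum_eq_zero fun s hs => ?_
  have hsH : s < H := lt_of_lt_of_le (mem_range.1 hs) ht
  have : isFair R H E y s = false := by
    simp [isFair, not_le.2 hsH]
  rw [this]; simp

/-- No empty-queue push is counted before `H`. [folklore] -/
theorem emptyPushes_of_le {t : ℕ} (ht : t ≤ H) : emptyPushes R H E y t = 0 := by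
  unfold emptyPushes
  rw [card_eq_zero, filter_eq_empty_iff]
  intro s hs h
  exact absurd (mem_range.1 hs) (not_lt.2 (ht.trans h.1))

/-! ### The fill -/

/-- During the fill nothing pops. [folklore] -/
theorem pops_fill {t : ℕ} (ht : t ≤ H) : pops (shedPrefix R H E y t) = 0 := by
  induction t with
  | zero => rfl
  | succ t ih =>
    rw [rankC_succ, ih (Nat.le_of_succ_le ht), shedLetter_of_lt_fill R H E y (Nat.lt_of_succ_le ht)]
    simp

/-- During the fill everything pushes. [folklore] -/
theorem pushes_fill {t : ℕ} (ht : t ≤ H) : pushes (shedPrefix R H E y t) = t := by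
  have h := pushes_add_pops (shedPrefix R H E y t)
  rw [length_shedPrefix, pops_fill R H E y ht] at h
  simpa using h

/-- **After the fill the S-content is the number of non-defect fill positions** (`H ≤ N`). [folklore] -/
theorem sContent_fill (hH : H ≤ N) {t : ℕ} (ht : t ≤ H) : sContent R H E y t = freeCount R 0 t := by
  induction t with
  | zero => simp [sContent, freeCount, pushes_fill R H E y (Nat.zero_le _)]
  | succ t ih =>
    have htN : t < N := lt_of_lt_of_le (Nat.lt_of_succ_le ht) hH
    rw [sContent_succ_of_push R H E y htN (shedLetter_of_lt_fill R H E y (Nat.lt_of_succ_le ht)), ih (Nat.le_of_succ_le ht),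
      freeCount_succ R (Nat.zero_le t)]
    cases isDefect R t <;> simp

/-! ### The S-content is the fill plus the empty pushes plus the fair walk -/

/-- **S-content identity** on `[H, E]` (`E ≤ N`). [folklore] -/
theorem sContent_eq (hEN : E ≤ N) {t : ℕ} (hHt : H ≤ t) (htE : t ≤ E) :
    (sContent R H E y t : ℤ) = freeCount R 0 H + emptyPushes R H E y t + fairWalk R H E y t := by
  induction t, hHt using Nat.le_induction with
  | base =>
    rw [sContent_fill R H E y (le_trans (le_trans le_rfl (le_of_eq rfl)) (le_trans htE hEN)) le_rfl,
      emptyPushes_of_le R H E y le_rfl, fairWalk_of_le R H E y le_rfl]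
    simp
  | succ t hHt ih =>
    have ih := ih (Nat.le_of_succ_le htE)
    have htE' : t < E := Nat.lt_of_succ_le htE
    have htN : t < N := lt_of_lt_of_le htE' hEN
    rw [fairWalk_succ, emptyPushes_succ]
    by_cases hd : isDefect R t = true
    · -- a defect pushes an R-item
      have hs := sContent_succ_of_push R H E y htN (shedLetter_of_isDefect R H E y hd)
      rw [hd, if_pos rfl, add_zero] at hs
      have hnf : isFair R H E y t = false := by simp [isFair, hd]
      have hne : ¬ (H ≤ t ∧ isDefect R t = false ∧ pushes (shedPrefix R H E y t) ≤ pops (shedPrefix R H E y t)) :=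
        fun h => by rw [hd] at h; exact Bool.noConfusion h.2.1
      rw [hnf, if_neg hne, hs]
      simp only [Bool.false_eq_true, if_false, add_zero]
      exact ih
    rw [Bool.not_eq_true] at hd
    by_cases he : pushes (shedPrefix R H E y t) ≤ pops (shedPrefix R H E y t)
    · -- empty queue: an S-item is pushed
      have hs := sContent_succ_of_push R H E y htN (shedLetter_of_empty R H E y he)
      rw [hd] at hs
      simp only [Bool.false_eq_true, if_false] at hs
      have hnf : isFair R H E y t = false := by simp [isFair, not_lt.2 he]
      rw [hnf, if_pos ⟨hHt, hd, he⟩, hs]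
      simp only [Bool.false_eq_true, if_false, add_zero]
      push_cast; omega
    rw [not_le] at he
    have hne : ¬ (H ≤ t ∧ isDefect R t = false ∧ pushes (shedPrefix R H E y t) ≤ pops (shedPrefix R H E y t)) :=
      fun h => absurd h.2.2 (not_le.2 he)
    rw [if_neg hne, add_zero]
    by_cases hfront : isDefect R (frontPos (shedPrefix R H E y t)) = true
    · -- shed: an R-item is popped
      have hpop := shedLetter_shed R H E y hd hHt he htE' hfront
      have hs := sContent_succ_of_pop R H E y htN hpop
      rw [hfront, if_pos rfl, add_zero] at hs
      have hnf : isFair R H E y t = false := by simp [isFair, hfront]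
      rw [hnf, hs]
      simp only [Bool.false_eq_true, if_false, add_zero]
      exact ih
    · -- fair: the bit decides
      rw [Bool.not_eq_true] at hfront
      have hfair : isFair R H E y t = true := by
        simp [isFair, hd, hHt, he, htE', hfront]
      have hletter := shedLetter_of_isFair R H E y hfair
      rw [hfair, if_pos rfl]
      by_cases hb : bit y t = true
      · rw [hb] at hletter
        have hs := sContent_succ_of_push R H E y htN hletter
        rw [hd] at hs
        simp only [Bool.false_eq_true, if_false] at hs
        rw [hb, if_pos rfl, hs]
        push_cast; omega
      · rw [Bool.not_eq_true] at hb
        rw [hb] at hletter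
        have hs := sContent_succ_of_pop R H E y htN hletter
        rw [hfront] at hs
        simp only [Bool.false_eq_true, if_false] at hs
        rw [hb]
        simp only [Bool.false_eq_true, if_false]
        have : (sContent R H E y (t + 1) : ℤ) = sContent R H E y t - 1 := by
          have := hs; omega
        rw [this, ih]; ring

/-- **No empty pushes while the walk stays above `−freeCount R 0 H`**: then on `[H, t]` the queue is never empty and
`sContent = freeCount R 0 H + fairWalk` exactly. [folklore] -/
theorem sContent_eq_of_walk_gt (hEN : E ≤ N) {t : ℕ} (hHt : H ≤ t) (htE : t ≤ E)
    (hwalk : ∀ s, H ≤ s → s ≤ t → -(freeCount R 0 H : ℤ) < fairWalk R H E y s) :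
    emptyPushes R H E y t = 0 ∧ (sContent R H E y t : ℤ) = freeCount R 0 H + fairWalk R H E y t := by
  induction t, hHt using Nat.le_induction with
  | base =>
    refine ⟨emptyPushes_of_le R H E y le_rfl, ?_⟩
    have h := sContent_eq R H E y hEN le_rfl htE
    rw [emptyPushes_of_le R H E y le_rfl] at h
    simpa using h
  | succ t hHt ih =>
    obtain ⟨ih1, ih2⟩ := ih (Nat.le_of_succ_le htE) fun s h1 h2 => hwalk s h1 (h2.trans (Nat.le_succ t))
    have hpos : 0 < sContent R H E y t := by
      have := hwalk t hHt (Nat.le_succ t)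
      have h2 : (0 : ℤ) < sContent R H E y t := by rw [ih2]; omega
      exact_mod_cast h2
    have hne : pops (shedPrefix R H E y t) < pushes (shedPrefix R H E y t) := by
      by_contra hle
      rw [not_lt] at hle
      unfold sContent at hpos
      rw [Finset.Ico_eq_empty_of_le hle] at hpos
      simp at hpos
    have h1 : emptyPushes R H E y (t + 1) = 0 := by
      rw [emptyPushes_succ, ih1, if_neg (fun h => absurd h.2.2 (not_le.2 hne))]
    refine ⟨h1, ?_⟩
    have h := sContent_eq R H E y hEN (hHt.trans (Nat.le_succ t)) htE
    rw [h1] at h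
    simpa using h

/-- Inside the band the queue is non-empty. [folklore] -/
theorem pops_lt_pushes_of_sContent_pos {t : ℕ} (h : 0 < sContent R H E y t) :
    pops (shedPrefix R H E y t) < pushes (shedPrefix R H E y t) := by
  by_contra hle
  rw [not_lt] at hle
  unfold sContent at h
  rw [Finset.Ico_eq_empty_of_le hle] at h
  simp at h

end Summit.ValiantsHypothesis.ValiantsHypothesis.Theorems.FifoMatching.NNLinearDegreeCofactorHard.ShedWord
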